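import Summits.AtomisticToContinuum.HydrodynamicLimit.Theorems.EnskogAdjointDualityAdjointEnskogTestFamilyRRefPsiOperator
import Summits.AtomisticToContinuum.HydrodynamicLimit.Theorems.EnskogAdjointDualityAdjointEnskogTestFamilyRHalfGaussian
import Summits.AtomisticToContinuum.HydrodynamicLimit.Theorems.EnskogAdjointDualityAdjointEnskogTestFamilyRRadialSymmetry
import Summits.AtomisticToContinuum.HydrodynamicLimit.Theorems.EnskogAdjointDualityAdjointEnskogTestFamilyRSphereCalculus
import HarnessLib

/-!
# K2R refutation, identity (I), `ψ`-part — weights and profiles (stub `psiOne`, file 1 of 3)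

Route `EnskogAdjointDuality` of `AtomisticToContinuum/HydrodynamicLimit`, crux K2R `AdjointEnskogTestFamilyR`
(stmt-AtomisticToContinuum-11592), line `refutation`, registered stub `stub_psiOne` (identity (I): the defect
inequality tested against `z sin(2πx₀)` and the dipole weight `Θ₁^R(v) = |v|(1+|v|²)⁻⁴e^{-|v|²/R} v₀`).
Velocity-side ingredients of the assembly (file `…RPsiOne`), all stated for opaque functions pinned by their
defining equations: the half-Gaussian profiles `P₂`, `P₃` of the collisional transfer of `ψ = α + β·v + γ|v|²/2`
(`k2r_ref_p1_P_facts`, from `stub_halfGaussian`); the transfer bracket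
`br = ⟪β(x⁺)−β(x),ω⟫P₂(v·ω) + (γ(x⁺)−γ(x))/2·P₃(v·ω)` (cubic bound) and the closed-form operator
`Lψ = λ∫Y₀ρ₀ br dσ` (continuity, size); the radial weight `th_R(v) = √(|v|²)(1+|v|²)⁻⁴e^{-|v|²/R}` (keyed
sub-goal `stub_psiOne_weights`: `th_R (1+|v|²)³ ≤ |v|e^{-|v|²/R}`), its moments (from `stub_sphereCalculus`),
the rotation `∫ th v₀ P(v·ω) = ω₀ ∫ th v₀ P(v₀)` (from `stub_radialSymmetry`) and the sizes `|q₂| ≤ 40`,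
`|q₃ − (π/5) J'_R| ≤ 120` of the first moments `q_k = ∫ th v₀ P_k(v₀)`.

References: C. Cercignani, R. Illner, M. Pulvirenti, *The Mathematical Theory of Dilute Gases* (1994),
§3.1 [CIP1994]; S. Chapman, T. G. Cowling (1970), §16.
-/

noncomputable section

open MeasureTheory Set Filter Function Metric
open scoped InnerProductSpace Real

namespace Summit.AtomisticToContinuum.HydrodynamicLimit.Theorems.EnskogAdjointDuality

open Literature.MathematicalPhysics.KineticTheory Literature.Analysis.FluidPDE Literature.Analysis.FunctionSpaces

/-! ## The half-Gaussian profiles `P₂`, `P₃` and the transfer bracket -/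

/-- **The profiles `P₂`, `P₃`** (from `stub_halfGaussian`): continuous functions with `0 ≤ P₂(a) ≤ 1 + a²`,
`|P₃(a) − a₊³| ≤ 3(1+|a|)`, the integrability of the flux weight `q₊(1+|w|²)M` and the marginal identities
`∫ q₊ q M dw = P₂(v·ω)`, `∫ q₊((v·ω)² − (w·ω)²) M dw = P₃(v·ω)`. [cite: CIP1994, §3.1] -/
theorem k2r_ref_p1_P_facts : ∃ P2 P3 : ℝ → ℝ,
    Continuous P2 ∧ Continuous P3 ∧ (∀ a, 0 ≤ P2 a ∧ P2 a ≤ 1 + a ^ 2) ∧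
    (∀ a, |P3 a - max a 0 ^ 3| ≤ 3 * (1 + |a|)) ∧
    (∀ (ω : sphere (0 : V3) 1) (v : V3),
      (Integrable fun w : V3 => max ⟪v - w, (ω : V3)⟫_ℝ 0 * (1 + ‖w‖ ^ 2) * globalMaxwellian w) ∧
      (∫ w : V3, max ⟪v - w, (ω : V3)⟫_ℝ 0 * ⟪v - w, (ω : V3)⟫_ℝ * globalMaxwellian w) = P2 ⟪v, (ω : V3)⟫_ℝ ∧
      (∫ w : V3, max ⟪v - w, (ω : V3)⟫_ℝ 0 * (⟪v, (ω : V3)⟫_ℝ ^ 2 - ⟪w, (ω : V3)⟫_ℝ ^ 2) *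
        globalMaxwellian w) = P3 ⟪v, (ω : V3)⟫_ℝ) := by
  obtain ⟨⟨-, c2, c3⟩, -, hP2, hP3, hm, -⟩ := stub_halfGaussian
  exact ⟨_, _, c2, c3, hP2, hP3, fun ω v => ⟨(hm ω v).1, (hm ω v).2.2.1, (hm ω v).2.2.2⟩⟩

/-- **Cubic growth of the transfer bracket**: for `‖b‖ ≤ 2C`, `|c| ≤ 2C` and a unit `ω`,
`|⟪b,ω⟫ P₂(v·ω) + (c/2) P₃(v·ω)| ≤ 9C (1+|v|²)⁴`. [cite: CIP1994, §3.1] -/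
theorem k2r_ref_p1_bracket_abs_le {P2 P3 : ℝ → ℝ} (hP2 : ∀ a, 0 ≤ P2 a ∧ P2 a ≤ 1 + a ^ 2)
    (hP3 : ∀ a, |P3 a - max a 0 ^ 3| ≤ 3 * (1 + |a|)) {C c : ℝ} {b : V3} (ω : sphere (0 : V3) 1) (v : V3)
    (hb : ‖b‖ ≤ 2 * C) (hc : |c| ≤ 2 * C) :
    |⟪b, (ω : V3)⟫_ℝ * P2 ⟪v, (ω : V3)⟫_ℝ + c / 2 * P3 ⟪v, (ω : V3)⟫_ℝ| ≤ 9 * C * (1 + ‖v‖ ^ 2) ^ 4 := by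
  have hω : ‖(ω : V3)‖ = 1 := norm_eq_of_mem_sphere ω
  have hC : 0 ≤ C := by linarith [norm_nonneg b]
  set a : ℝ := ⟪v, (ω : V3)⟫_ℝ with ha
  have ha1 : |a| ≤ ‖v‖ := by simpa [hω] using abs_real_inner_le_norm v (ω : V3)
  have hbω : |⟪b, (ω : V3)⟫_ℝ| ≤ 2 * C :=
    (abs_real_inner_le_norm _ _).trans (by rw [hω, mul_one]; exact hb)
  set s : ℝ := 1 + ‖v‖ ^ 2 with hs
  have ht0 : 0 ≤ ‖v‖ := norm_nonneg v
  have hs1 : 1 ≤ s := by rw [hs]; nlinarith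
  have ht : ‖v‖ ≤ s := by rw [hs]; nlinarith [sq_nonneg (‖v‖ - 1)]
  have h2 : |P2 a| ≤ s := by
    rw [abs_of_nonneg (hP2 a).1]
    have ha2 : a ^ 2 ≤ ‖v‖ ^ 2 := by
      rw [← sq_abs]; exact pow_le_pow_left₀ (abs_nonneg a) ha1 2
    calc P2 a ≤ 1 + a ^ 2 := (hP2 a).2
      _ ≤ s := by rw [hs]; linarith
  have h3 : |P3 a| ≤ ‖v‖ ^ 3 + 3 * (1 + ‖v‖) := by
    have hm : |max a 0 ^ 3| ≤ ‖v‖ ^ 3 := by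
      rw [abs_pow]; exact pow_le_pow_left₀ (abs_nonneg _) ((k2r_ref_abs_posPart_le a).trans ha1) 3
    calc |P3 a| = |(P3 a - max a 0 ^ 3) + max a 0 ^ 3| := by rw [sub_add_cancel]
      _ ≤ |P3 a - max a 0 ^ 3| + |max a 0 ^ 3| := abs_add_le _ _
      _ ≤ 3 * (1 + |a|) + ‖v‖ ^ 3 := add_le_add (hP3 a) hm
      _ ≤ ‖v‖ ^ 3 + 3 * (1 + ‖v‖) := by linarith
  have hs4 : s ≤ s ^ 4 := le_self_pow₀ hs1 (by norm_num)
  have hs24 : s ^ 2 ≤ s ^ 4 := pow_le_pow_right₀ hs1 (by norm_num)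
  have hv3 : ‖v‖ ^ 3 ≤ s ^ 4 := by
    have h : ‖v‖ ^ 3 ≤ s ^ 2 := by
      calc ‖v‖ ^ 3 = ‖v‖ * ‖v‖ ^ 2 := by ring
        _ ≤ s * s := mul_le_mul ht (by rw [hs]; linarith) (sq_nonneg _) (by linarith)
        _ = s ^ 2 := by ring
    exact h.trans hs24
  have k1 := mul_le_mul_of_nonneg_left hs4 hC
  have k2 := mul_le_mul_of_nonneg_left hv3 hC
  have k3 := mul_le_mul_of_nonneg_left (hs1.trans hs4) hC
  have k4 := mul_le_mul_of_nonneg_left (ht.trans hs4) hC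
  calc |⟪b, (ω : V3)⟫_ℝ * P2 a + c / 2 * P3 a|
      ≤ |⟪b, (ω : V3)⟫_ℝ * P2 a| + |c / 2 * P3 a| := abs_add_le _ _
    _ = |⟪b, (ω : V3)⟫_ℝ| * |P2 a| + |c| / 2 * |P3 a| := by rw [abs_mul, abs_mul, abs_div, abs_two]
    _ ≤ 2 * C * s + 2 * C / 2 * (‖v‖ ^ 3 + 3 * (1 + ‖v‖)) :=
        add_le_add (mul_le_mul hbω h2 (abs_nonneg _) (by linarith))
          (mul_le_mul (by linarith) h3 (abs_nonneg _) (by linarith))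
    _ ≤ 9 * C * s ^ 4 := by nlinarith

/-- **The transfer bracket** `br x v ω = ⟪β(x⁺)−β(x),ω⟫ P₂(v·ω) + (γ(x⁺)−γ(x))/2 · P₃(v·ω)` (`x⁺ = x + εω`)
for continuous coefficients with `‖cc‖ ≤ C`: joint continuity and `|br| ≤ 9C(1+|v|²)⁴`. [cite: CIP1994, §3.1] -/
theorem k2r_ref_p1_br_facts {P2 P3 : ℝ → ℝ} (c2 : Continuous P2) (c3 : Continuous P3)
    (hP2 : ∀ a, 0 ≤ P2 a ∧ P2 a ≤ 1 + a ^ 2) (hP3 : ∀ a, |P3 a - max a 0 ^ 3| ≤ 3 * (1 + |a|))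
    {C ε : ℝ} {cc : T3 → ℝ × V3 × ℝ} (hcc : Continuous cc) (hbd : ∀ x, ‖cc x‖ ≤ C)
    {br : T3 → V3 → sphere (0 : V3) 1 → ℝ}
    (hbr : ∀ x v ω, br x v ω = ⟪(cc (x + Torus.proj (ε • (ω : V3)))).2.1 - (cc x).2.1, (ω : V3)⟫_ℝ *
        P2 ⟪v, (ω : V3)⟫_ℝ + ((cc (x + Torus.proj (ε • (ω : V3)))).2.2 - (cc x).2.2) / 2 * P3 ⟪v, (ω : V3)⟫_ℝ) :
    Continuous (fun q : (T3 × V3) × sphere (0 : V3) 1 => br q.1.1 q.1.2 q.2) ∧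
    ∀ (x : T3) (v : V3) (ω : sphere (0 : V3) 1), |br x v ω| ≤ 9 * C * (1 + ‖v‖ ^ 2) ^ 4 := by
  have hp := Torus.continuous_proj (d := Fin 3)
  have hβ : ∀ y, ‖(cc y).2.1‖ ≤ C := fun y => ((norm_fst_le _).trans (norm_snd_le _)).trans (hbd y)
  have hγ : ∀ y, |(cc y).2.2| ≤ C := fun y => by
    rw [← Real.norm_eq_abs]; exact ((norm_snd_le _).trans (norm_snd_le _)).trans (hbd y)
  refine ⟨?_, fun x v ω => ?_⟩
  · have e : (fun q : (T3 × V3) × sphere (0 : V3) 1 => br q.1.1 q.1.2 q.2) =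
        fun q => ⟪(cc (q.1.1 + Torus.proj (ε • (q.2 : V3)))).2.1 - (cc q.1.1).2.1, (q.2 : V3)⟫_ℝ *
          P2 ⟪q.1.2, (q.2 : V3)⟫_ℝ +
          ((cc (q.1.1 + Torus.proj (ε • (q.2 : V3)))).2.2 - (cc q.1.1).2.2) / 2 * P3 ⟪q.1.2, (q.2 : V3)⟫_ℝ :=
      funext fun q => hbr _ _ _
    rw [e]
    fun_prop
  · rw [hbr]
    refine k2r_ref_p1_bracket_abs_le hP2 hP3 ω v ?_ ?_
    · exact (norm_sub_le _ _).trans (by linarith [hβ (x + Torus.proj (ε • (ω : V3))), hβ x])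
    · exact (abs_sub _ _).trans (by linarith [hγ (x + Torus.proj (ε • (ω : V3))), hγ x])

/-- **The closed-form operator** `Lψ = λ ∫ Y₀ρ₀ · br dσ`: joint continuity in `(x, v)` and the size
`|Lψ x v| ≤ λ · 4π · Y₀ρ₀ · 9C (1+|v|²)⁴`. [cite: CIP1994, §3.1] -/
theorem k2r_ref_p1_L_facts {P2 P3 : ℝ → ℝ} (c2 : Continuous P2) (c3 : Continuous P3)
    (hP2 : ∀ a, 0 ≤ P2 a ∧ P2 a ≤ 1 + a ^ 2) (hP3 : ∀ a, |P3 a - max a 0 ^ 3| ≤ 3 * (1 + |a|))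
    {Y₀ ρ₀ ε lam C : ℝ} (hY : 0 ≤ Y₀ * ρ₀) (hlam : 0 ≤ lam)
    {cc : T3 → ℝ × V3 × ℝ} (hcc : Continuous cc) (hbd : ∀ x, ‖cc x‖ ≤ C)
    {br : T3 → V3 → sphere (0 : V3) 1 → ℝ}
    (hbr : ∀ x v ω, br x v ω = ⟪(cc (x + Torus.proj (ε • (ω : V3)))).2.1 - (cc x).2.1, (ω : V3)⟫_ℝ *
        P2 ⟪v, (ω : V3)⟫_ℝ + ((cc (x + Torus.proj (ε • (ω : V3)))).2.2 - (cc x).2.2) / 2 * P3 ⟪v, (ω : V3)⟫_ℝ)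
    {Lψ : T3 → V3 → ℝ}
    (hL : ∀ x v, Lψ x v = lam * ∫ ω : sphere (0 : V3) 1, Y₀ * ρ₀ * br x v ω ∂sphereMeasure) :
    Continuous (fun p : T3 × V3 => Lψ p.1 p.2) ∧
    ∀ x v, |Lψ x v| ≤ lam * (4 * Real.pi * (Y₀ * ρ₀ * (9 * C * (1 + ‖v‖ ^ 2) ^ 4))) := by
  haveI := isFiniteMeasure_sphereMeasure (E := V3)
  obtain ⟨hbc, hble⟩ := k2r_ref_p1_br_facts c2 c3 hP2 hP3 hcc hbd hbr
  constructor
  · have e : (fun p : T3 × V3 => Lψ p.1 p.2) = fun p : T3 × V3 =>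
        lam * ∫ ω : sphere (0 : V3) 1, Y₀ * ρ₀ * br p.1 p.2 ω ∂sphereMeasure := funext fun p => hL p.1 p.2
    rw [e]
    have h := continuous_parametric_integral_of_continuous
      (μ := (sphereMeasure : Measure (sphere (0 : V3) 1)))
      (f := fun (p : T3 × V3) (ω : sphere (0 : V3) 1) => Y₀ * ρ₀ * br p.1 p.2 ω)
      (continuous_const.mul hbc) isCompact_univ
    simp only [Measure.restrict_univ] at h
    exact continuous_const.mul h
  · intro x v
    have hb : ∀ ω : sphere (0 : V3) 1, ‖Y₀ * ρ₀ * br x v ω‖ ≤ Y₀ * ρ₀ * (9 * C * (1 + ‖v‖ ^ 2) ^ 4) :=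
      fun ω => by
      rw [Real.norm_eq_abs, abs_mul, abs_of_nonneg hY]
      exact mul_le_mul_of_nonneg_left (hble x v ω) hY
    have h := norm_integral_le_of_norm_le_const (μ := (sphereMeasure : Measure (sphere (0 : V3) 1)))
      (Eventually.of_forall hb)
    rw [k2r_sphereMeasure_real_univ, Real.norm_eq_abs] at h
    rw [hL x v, abs_mul, abs_of_nonneg hlam]
    exact mul_le_mul_of_nonneg_left (h.trans_eq (by ring)) hlam

/-! ## The radial weight `th_R` and its moments -/

/-- `th_R(v) (1+|v|²)³ ≤ |v| e^{-|v|²/R}` for `th_R(v) = √(|v|²)(1+|v|²)⁻⁴e^{-|v|²/R}`. [folklore] -/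
theorem k2r_ref_p1_th_mul_le (R : ℝ) (v : V3) :
    Real.sqrt (‖v‖ ^ 2) * ((1 + ‖v‖ ^ 2) ^ 4)⁻¹ * Real.exp (-‖v‖ ^ 2 / R) * (1 + ‖v‖ ^ 2) ^ 3 ≤
      ‖v‖ * Real.exp (-‖v‖ ^ 2 / R) := by
  rw [Real.sqrt_sq (norm_nonneg v)]
  have hq : (1 : ℝ) ≤ 1 + ‖v‖ ^ 2 := by nlinarith [norm_nonneg v]
  have h1 : (1 + ‖v‖ ^ 2) ^ 3 / (1 + ‖v‖ ^ 2) ^ 4 ≤ 1 :=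
    div_le_one_of_le₀ (pow_le_pow_right₀ hq (by norm_num)) (by positivity)
  calc ‖v‖ * ((1 + ‖v‖ ^ 2) ^ 4)⁻¹ * Real.exp (-‖v‖ ^ 2 / R) * (1 + ‖v‖ ^ 2) ^ 3
      = ‖v‖ * Real.exp (-‖v‖ ^ 2 / R) * ((1 + ‖v‖ ^ 2) ^ 3 / (1 + ‖v‖ ^ 2) ^ 4) := by ring
    _ ≤ ‖v‖ * Real.exp (-‖v‖ ^ 2 / R) * 1 := by gcongr
    _ = _ := mul_one _

/-- **The weight `th_R` and its moments** (`R ≥ 1`; from `stub_sphereCalculus`): continuity, `th_R ≥ 0`,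
`∫ |v|ᵏ th_R ≤ 20` (`k ≤ 3`), `∫ th_R (v₀)₊⁴ = (π/5) J'_R`, `∫ th_R v₀²|v|² = (2π/3) J'_R`,
`th_R |v₀| (1+|v|²)⁴ ∈ L¹`. [folklore] -/
theorem k2r_ref_p1_th_facts {R : ℝ} (hR : 1 ≤ R) {th : V3 → ℝ}
    (hth : ∀ v, th v = Real.sqrt (‖v‖ ^ 2) * ((1 + ‖v‖ ^ 2) ^ 4)⁻¹ * Real.exp (-‖v‖ ^ 2 / R)) :
    Continuous th ∧ (∀ v, 0 ≤ th v) ∧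
    (∀ k : ℕ, k ≤ 3 → Integrable (fun v : V3 => ‖v‖ ^ k * th v) ∧ ∫ v : V3, ‖v‖ ^ k * th v ≤ 20) ∧
    (Integrable (fun v : V3 => th v * max (v 0) 0 ^ 4) ∧
      ∫ v : V3, th v * max (v 0) 0 ^ 4 =
        Real.pi / 5 * ∫ E in Ioi (0 : ℝ), E ^ 3 * ((1 + E) ^ 4)⁻¹ * Real.exp (-E / R)) ∧
    (Integrable (fun v : V3 => th v * v 0 ^ 2 * ‖v‖ ^ 2) ∧
      ∫ v : V3, th v * v 0 ^ 2 * ‖v‖ ^ 2 =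
        2 * Real.pi / 3 * ∫ E in Ioi (0 : ℝ), E ^ 3 * ((1 + E) ^ 4)⁻¹ * Real.exp (-E / R)) ∧
    Integrable (fun v : V3 => th v * |v 0| * (1 + ‖v‖ ^ 2) ^ 4) := by
  obtain rfl : th = fun v => Real.sqrt (‖v‖ ^ 2) * ((1 + ‖v‖ ^ 2) ^ 4)⁻¹ * Real.exp (-‖v‖ ^ 2 / R) :=
    funext hth
  obtain ⟨-, h2, -, -, -, h6, h7, h8, -⟩ := k2r_ref_R3_facts hR
  refine ⟨by fun_prop (disch := intros; positivity), fun v => by positivity, h2, h6, h7, h8⟩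

/-- **Rotation of the first moments to the pole** (`stub_radialSymmetry` for the weight `th_R`, which is the
continuous radial profile `√E (1+|E|)⁻⁴ e^{-E/R}` at `E = |v|²`, and profiles `P` of cubic growth):
integrability of `th_R v₀ P(v·ω)` and `∫ th_R v₀ P(v·ω) dv = ω₀ ∫ th_R v₀ P(v₀) dv`, for `P = P₂, P₃`.
[folklore] -/
theorem k2r_ref_p1_rotation {R : ℝ} (hR : 1 ≤ R) {th : V3 → ℝ}
    (hth : ∀ v, th v = Real.sqrt (‖v‖ ^ 2) * ((1 + ‖v‖ ^ 2) ^ 4)⁻¹ * Real.exp (-‖v‖ ^ 2 / R))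
    {P2 P3 : ℝ → ℝ} (c2 : Continuous P2) (c3 : Continuous P3)
    (hP2 : ∀ a, 0 ≤ P2 a ∧ P2 a ≤ 1 + a ^ 2) (hP3 : ∀ a, |P3 a - max a 0 ^ 3| ≤ 3 * (1 + |a|))
    (ω : sphere (0 : V3) 1) :
    Integrable (fun v : V3 => th v * v 0 * P2 ⟪v, (ω : V3)⟫_ℝ) ∧
    Integrable (fun v : V3 => th v * v 0 * P3 ⟪v, (ω : V3)⟫_ℝ) ∧
    (∫ v : V3, th v * v 0 * P2 ⟪v, (ω : V3)⟫_ℝ) = (ω : V3) 0 * ∫ v : V3, th v * v 0 * P2 (v 0) ∧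
    (∫ v : V3, th v * v 0 * P3 ⟪v, (ω : V3)⟫_ℝ) = (ω : V3) 0 * ∫ v : V3, th v * v 0 * P3 (v 0) := by
  have hR0 : 0 < R := by linarith
  -- a continuous radial profile of `th`
  set ϑ : ℝ → ℝ := fun E => Real.sqrt E * ((1 + |E|) ^ 4)⁻¹ * Real.exp (-E / R) with hϑdef
  have hϑ : Continuous ϑ := by
    rw [hϑdef]; fun_prop (disch := intros; positivity)
  have hϑth : ∀ v : V3, ϑ (‖v‖ ^ 2) = th v := fun v => by
    rw [hth v, hϑdef]
    simp only [abs_of_nonneg (sq_nonneg ‖v‖)]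
  have hD : Integrable (fun v : V3 => |ϑ (‖v‖ ^ 2)| * (1 + ‖v‖ ^ 2) ^ 3) := by
    refine k2r_ref_integrable_of_norm_le (by fun_prop) (fun r => r * Real.exp (-r ^ 2 / R))
      ((k2r_ref_integrableOn_pow_mul_exp hR0 3).congr_fun (fun r _ => by ring) measurableSet_Ioi)
      fun v => ?_
    have h0 : 0 ≤ ϑ (‖v‖ ^ 2) := by rw [hϑdef]; positivity
    rw [abs_of_nonneg (mul_nonneg (abs_nonneg _) (by positivity)), abs_of_nonneg h0, hϑth, hth]
    exact k2r_ref_p1_th_mul_le R v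
  have hb2 : ∀ a, |P2 a| ≤ 1 * (1 + |a|) ^ 3 := fun a => by
    rw [abs_of_nonneg (hP2 a).1, one_mul]
    calc P2 a ≤ 1 + a ^ 2 := (hP2 a).2
      _ ≤ (1 + |a|) ^ 3 := by rw [← sq_abs]; nlinarith [abs_nonneg a, sq_nonneg |a|]
  have hb3 : ∀ a, |P3 a| ≤ 4 * (1 + |a|) ^ 3 := fun a => by
    have hm : |max a 0 ^ 3| ≤ |a| ^ 3 := by
      rw [abs_pow]; exact pow_le_pow_left₀ (abs_nonneg _) (k2r_ref_abs_posPart_le a) 3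
    calc |P3 a| = |(P3 a - max a 0 ^ 3) + max a 0 ^ 3| := by rw [sub_add_cancel]
      _ ≤ |P3 a - max a 0 ^ 3| + |max a 0 ^ 3| := abs_add_le _ _
      _ ≤ 3 * (1 + |a|) + |a| ^ 3 := add_le_add (hP3 a) hm
      _ ≤ 4 * (1 + |a|) ^ 3 := by nlinarith [abs_nonneg a, sq_nonneg |a|]
  obtain ⟨-, -, -, h4⟩ := stub_radialSymmetry ϑ P2 1 hϑ c2 hb2 hD
  obtain ⟨-, -, -, h4'⟩ := stub_radialSymmetry ϑ P3 4 hϑ c3 hb3 hD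
  obtain ⟨-, i2, -, r2, -⟩ := h4 ω
  obtain ⟨-, i3, -, r3, -⟩ := h4' ω
  simp only [hϑth] at i2 i3 r2 r3
  exact ⟨i2, i3, r2, r3⟩

/-- `|q₂| = |∫ th_R v₀ P₂(v₀) dv| ≤ 40` (`0 ≤ P₂(a) ≤ 1 + a²` and the moments `≤ 20`). [folklore] -/
theorem k2r_ref_p1_q2_abs_le {R : ℝ} (hR : 1 ≤ R) {th : V3 → ℝ}
    (hth : ∀ v, th v = Real.sqrt (‖v‖ ^ 2) * ((1 + ‖v‖ ^ 2) ^ 4)⁻¹ * Real.exp (-‖v‖ ^ 2 / R))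
    {P2 : ℝ → ℝ} (hP2 : ∀ a, 0 ≤ P2 a ∧ P2 a ≤ 1 + a ^ 2) {q2 : ℝ}
    (hq2 : q2 = ∫ v : V3, th v * v 0 * P2 (v 0)) : |q2| ≤ 40 := by
  obtain ⟨-, hth0, hmom, -⟩ := k2r_ref_p1_th_facts hR hth
  obtain ⟨i1, b1⟩ := hmom 1 (by norm_num)
  obtain ⟨i3, b3⟩ := hmom 3 le_rfl
  have hv0 : ∀ v : V3, |v 0| ≤ ‖v‖ := fun v => by simpa using PiLp.norm_apply_le v 0
  have hle : ∀ v : V3, ‖th v * v 0 * P2 (v 0)‖ ≤ ‖v‖ ^ 1 * th v + ‖v‖ ^ 3 * th v := fun v => by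
    have hthv := hth0 v
    rw [Real.norm_eq_abs, abs_mul, abs_mul, abs_of_nonneg hthv, abs_of_nonneg (hP2 _).1]
    have h02 : v 0 ^ 2 ≤ ‖v‖ ^ 2 := by
      rw [← sq_abs]; exact pow_le_pow_left₀ (abs_nonneg _) (hv0 v) 2
    calc th v * |v 0| * P2 (v 0) ≤ th v * ‖v‖ * (1 + v 0 ^ 2) :=
          mul_le_mul (mul_le_mul_of_nonneg_left (hv0 v) hthv) (hP2 _).2 (hP2 _).1 (by positivity)
      _ ≤ th v * ‖v‖ * (1 + ‖v‖ ^ 2) := by gcongr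
      _ = ‖v‖ ^ 1 * th v + ‖v‖ ^ 3 * th v := by ring
  have h := norm_integral_le_of_norm_le (i1.fun_add i3) (Eventually.of_forall hle)
  rw [integral_add i1 i3, Real.norm_eq_abs] at h
  rw [hq2]
  linarith

/-- `q₃ = ∫ th_R v₀ P₃(v₀) dv = (π/5) J'_R + O(1)`: `|q₃ − (π/5) J'_R| ≤ 120`
(`v₀ (v₀)₊³ = (v₀)₊⁴`, `|P₃(a) − a₊³| ≤ 3(1+|a|)`, moments `≤ 20`). [folklore] -/
theorem k2r_ref_p1_q3_split {R : ℝ} (hR : 1 ≤ R) {th : V3 → ℝ}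
    (hth : ∀ v, th v = Real.sqrt (‖v‖ ^ 2) * ((1 + ‖v‖ ^ 2) ^ 4)⁻¹ * Real.exp (-‖v‖ ^ 2 / R))
    {P3 : ℝ → ℝ} (c3 : Continuous P3) (hP3 : ∀ a, |P3 a - max a 0 ^ 3| ≤ 3 * (1 + |a|)) {q3 : ℝ}
    (hq3 : q3 = ∫ v : V3, th v * v 0 * P3 (v 0)) :
    |q3 - Real.pi / 5 * ∫ E in Ioi (0 : ℝ), E ^ 3 * ((1 + E) ^ 4)⁻¹ * Real.exp (-E / R)| ≤ 120 := by
  obtain ⟨hthc, hth0, hmom, ⟨i4, e4⟩, -, -⟩ := k2r_ref_p1_th_facts hR hth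
  obtain ⟨i1, b1⟩ := hmom 1 (by norm_num)
  obtain ⟨i2, b2⟩ := hmom 2 (by norm_num)
  have hv0 : ∀ v : V3, |v 0| ≤ ‖v‖ := fun v => by simpa using PiLp.norm_apply_le v 0
  have hsplit : ∀ v : V3, th v * v 0 * P3 (v 0) =
      th v * max (v 0) 0 ^ 4 + th v * v 0 * (P3 (v 0) - max (v 0) 0 ^ 3) := fun v => by
    have hm : v 0 * max (v 0) 0 ^ 3 = max (v 0) 0 ^ 4 := by
      rcases le_total 0 (v 0) with h | h
      · rw [max_eq_left h]; ring
      · rw [max_eq_right h]; ring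
    linear_combination th v * hm
  have hrem_le : ∀ v : V3, ‖th v * v 0 * (P3 (v 0) - max (v 0) 0 ^ 3)‖ ≤
      3 * (‖v‖ ^ 1 * th v + ‖v‖ ^ 2 * th v) := fun v => by
    have hthv := hth0 v
    rw [Real.norm_eq_abs, abs_mul, abs_mul, abs_of_nonneg hthv]
    have h1 : |P3 (v 0) - max (v 0) 0 ^ 3| ≤ 3 * (1 + ‖v‖) := (hP3 (v 0)).trans (by linarith [hv0 v])
    calc th v * |v 0| * |P3 (v 0) - max (v 0) 0 ^ 3| ≤ th v * ‖v‖ * (3 * (1 + ‖v‖)) :=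
          mul_le_mul (mul_le_mul_of_nonneg_left (hv0 v) hthv) h1 (abs_nonneg _) (by positivity)
      _ = 3 * (‖v‖ ^ 1 * th v + ‖v‖ ^ 2 * th v) := by ring
  have hrem_int : Integrable (fun v : V3 => th v * v 0 * (P3 (v 0) - max (v 0) 0 ^ 3)) :=
    ((i1.fun_add i2).const_mul 3).mono' (Continuous.aestronglyMeasurable (by fun_prop))
      (Eventually.of_forall hrem_le)
  rw [hq3, integral_congr_ae (Eventually.of_forall hsplit), integral_add i4 hrem_int, e4, add_sub_cancel_left]
  have h := norm_integral_le_of_norm_le ((i1.fun_add i2).const_mul 3) (Eventually.of_forall hrem_le)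
  rw [integral_const_mul, integral_add i1 i2, Real.norm_eq_abs] at h
  linarith

/-- **Registered sub-goal `stub_psiOne_weights`** (keyed theorem of this preparatory file): the weight
inequality `th_R(v) (1+|v|²)³ ≤ |v| e^{-|v|²/R}` (`k2r_ref_p1_th_mul_le`). [folklore] -/
theorem stub_psiOne_weights : ∀ (R : ℝ) (v : EuclideanSpace ℝ (Fin 3)), Real.sqrt (‖v‖ ^ 2) * ((1 + ‖v‖ ^ 2) ^ 4)⁻¹ * Real.exp (-‖v‖ ^ 2 / R) * (1 + ‖v‖ ^ 2) ^ 3 ≤ ‖v‖ * Real.exp (-‖v‖ ^ 2 / R) :=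
  k2r_ref_p1_th_mul_le

end Summit.AtomisticToContinuum.HydrodynamicLimit.Theorems.EnskogAdjointDuality
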